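import Summits.BirchSwinnertonDyer.Rank1Residual.X1.GeneratorCountTorsionLeaf
import Literature.NumberTheory.EllipticCurves.BSDRootNumberSmallConductorProofs
import HarnessLib

/-!
# Route M's generator COUNT, VIII (V80/V81 over `ℚ`, RATIONAL data): the torsion datum
# `#E[p^∞]^{Γ_ℚ} ≤ p^{v_p(#E(ℚ)_tors)}` by Galois descent, the `ℚ_p`-point from a rational point of
# order `p`, and the three leaf ends from `(v_p(#E(ℚ)_tors) ≤ k, E(ℚ)[p] ≠ 0)`
# (cell `b2b-bsdres`, unit `b2b-bsdres-eisenstein-p1`, gen 16)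

HONEST FRAMING (run/shared/lean/b2b/bsd-rank1-residual/, verbatim in every file): the goal of the
cell is to DELETE the COMBINATION-SHAPED residual classes of the Birch–Swinnerton-Dyer formula for
ALL analytic-rank `≤ 1` elliptic curves over `ℚ` — "full BSD formula for every rank `≤ 1` curve in
class `C`" assembled STRICTLY from published theorems — so that the rank-`≤ 1` remainder becomes
exactly the CONSTRUCTION-SHAPED classes, which are TYPED (missing-input `Prop`s), NOT attempted.
This is not "finishing BSD". Sub-cell `b2b-bsdres-eisenstein-p1`: research route; NO CLAIM BEYOND
STATED CLASSES; nothing here changes a label; nothing is booked (the per-pair rows served are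
EVIDENCE of this unit's table, referee to countersign). THEOREMS ONLY (no `def`, no named fact
introduced; named facts as in FILE VII: `hPT`, `hGrK`, and on the leaf Wuthrich 2014 Thm. 16,
Greenberg Thm. 4.1 / Prop. 3.10 / Prop. 4.15 (ii), modularity, Gross–Zagier–Kolyvagin).

What. FILE VII stated route M's count at a member WITH rational `p`-torsion with two per-member
data: `hB : #E[p^∞]^{Γ_ℚ} ≤ p^k` and a `ℚ_p`-point of order `p`. Here both are read off the
RATIONAL torsion: `natCard_fixedPoints_le_pow_factorization_torsionOrder` (Galois descent
`exists_toGeomPoints_eq_of_forall_smul_eq` into the `p`-primary part of the finite group `E(K)_tors`,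
whose order is `p^{v_p(#E(K)_tors)}` — tree `card_primaryComponent_eq_pow`, Sylow; any number field
`K`), `exists_point_baseChange_of_rationalPoint` (`E(ℚ) ↪ E(ℚ_v)`), and the leaf ends
`Leaf.generatorCountGE_of_rationalTorsion`, `Leaf.bsdp_of_muZero_of_tamagawaCount_rationalTorsion(_inter)`,
`Leaf.bsdp_of_muPartAt_of_tamagawaCount_rationalTorsion`: **a leaf pair, `S` with `p ∣ c_v`, a
rational point of order `p`, `v_p(#E(ℚ)_tors) ≤ k`, (Newton data), gap at `b` with
`b + 2k ≤ #S + 2` ⇒ `BSD(E,p)`** — with `k = 1`, `b = #S = t₀`: X1R0-GAPMAP §14.1's count at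
`δ = 1` (the 305 route-M₀ closures of §24.2 binding at `δ = 1` members), IN THE KERNEL modulo the
named facts and the typed Newton certificate.

References: [GreenbergLNM1716] §3 Lemma 3.1/3.4, §4 Lemma 4.3, §5 p. 114, p. 137; [SilvermanAEC2009]
VIII.§1, VII.7; X1R0-GAPMAP §14.1, §24.2, §25.
-/

noncomputable section

open scoped Classical

open Function Field NumberField IsDedekindDomain WeierstrassCurve
  Literature.NumberTheory.EllipticCurves Literature.NumberTheory.GaloisRepresentations
  Literature.NumberTheory.GaloisCohomology Summit.BirchSwinnertonDyer.Rank1Residual.GaloisImage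
  Summit.BirchSwinnertonDyer.Rank1Residual.X1.GeneratorCountAnomalous
  Summit.BirchSwinnertonDyer.Rank1Residual.X1.GeneratorCountAnomalousTwo
  Summit.BirchSwinnertonDyer.Rank1Residual.X1.GeneratorCountSqueeze
open Literature.NumberTheory.GaloisRepresentations.DiscreteGaloisModule (unramifiedSubgroup)

set_option autoImplicit false

namespace Summit.BirchSwinnertonDyer.Rank1Residual.X1.GeneratorCountTorsion

variable {W : WeierstrassCurve ℚ} [W.IsElliptic] [W.IsGloballyMinimal] {p : ℕ} [hp : Fact p.Prime]

/-! ## §7. The torsion datum from `#E(ℚ)_tors`, and the `ℚ_p`-point from a rational one -/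

section Dictionary

/-- **Galois descent, counted: `#E[p^∞]^{Γ_ℚ} ≤ p^{v_p(#E(ℚ)_tors)}`** (in fact `=`): a `Γ_ℚ`-fixed
point of `E[p^∞]` is (the image of) a rational torsion point of `p`-power order
(`exists_toGeomPoints_eq_of_forall_smul_eq`, `toGeomPoints_injective`), and the `p`-primary part of
the finite group `E(ℚ)_tors` has order `p^{v_p(#E(ℚ)_tors)}` (tree `card_primaryComponent_eq_pow`,
Sylow). So the torsion datum `hB` of §5–§6 holds with `k = v_p(#E(ℚ)_tors)` (`W.torsionOrder`).
[cite: SilvermanAEC2009, VIII.§1 (proof of Prop. 1.2) and Cor. VII.7.2] -/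
theorem natCard_fixedPoints_le_pow_factorization_torsionOrder {K : Type} [Field K] [NumberField K]
    (V : WeierstrassCurve K) [V.IsElliptic] (p : ℕ) [Fact p.Prime] :
    Nat.card {a : geomPrimaryTorsion V p // ∀ σ : absoluteGaloisGroup K, σ • a = a} ≤
      p ^ (V.torsionOrder).factorization p := by
  have hpp : p.Prime := Fact.out
  haveI : CharZero K := inferInstance
  haveI : PerfectField K := PerfectField.ofCharZero
  haveI hfinT : Finite (AddCommGroup.torsion V.toAffine.Point) := finite_torsion_holds V
  -- descent
  have key : ∀ a : {a : geomPrimaryTorsion V p // ∀ σ : absoluteGaloisGroup K, σ • a = a},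
      ∃ P : AddCommGroup.torsion V.toAffine.Point,
        toGeomPoints V (P : V.toAffine.Point) = ((a.1 : geomPrimaryTorsion V p) : geomPoints V) ∧
        ∃ k : ℕ, p ^ k • P = 0 := by
    intro a
    have hfix : ∀ σ : absoluteGaloisGroup K,
        σ • ((a.1 : geomPrimaryTorsion V p) : geomPoints V) =
          ((a.1 : geomPrimaryTorsion V p) : geomPoints V) :=
      fun σ ↦ by rw [← primaryComponent.coe_smul, a.2 σ]
    obtain ⟨P, hP⟩ := exists_toGeomPoints_eq_of_forall_smul_eq V hfix
    obtain ⟨k, hk⟩ := (a.1 : geomPrimaryTorsion V p).2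
    have hPk : p ^ k • P = 0 := toGeomPoints_injective V (by rw [map_nsmul, hP, map_zero]; exact hk)
    refine ⟨⟨P, ?_⟩, hP, k, Subtype.ext ?_⟩
    · rw [AddCommGroup.mem_torsion, isOfFinAddOrder_iff_nsmul_eq_zero]
      exact ⟨p ^ k, pow_pos hpp.pos k, hPk⟩
    · rw [AddSubmonoidClass.coe_nsmul]; exact hPk
  choose P hP hPk using key
  -- injection into the `p`-primary component of `Multiplicative E(K)_tors`
  let F : {a : geomPrimaryTorsion V p // ∀ σ : absoluteGaloisGroup K, σ • a = a} →
      CommGroup.primaryComponent (Multiplicative (AddCommGroup.torsion V.toAffine.Point)) p :=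
    fun a ↦ ⟨Multiplicative.ofAdd (P a), by
      obtain ⟨k, hk⟩ := hPk a
      exact ⟨k, by rw [← ofAdd_nsmul, hk, ofAdd_zero]⟩⟩
  have hF : Function.Injective F := by
    intro a b hab
    have h1 : P a = P b := Multiplicative.ofAdd.injective (congrArg Subtype.val hab)
    apply Subtype.ext; apply Subtype.ext
    rw [← hP a, ← hP b, h1]
  calc Nat.card {a : geomPrimaryTorsion V p // ∀ σ : absoluteGaloisGroup K, σ • a = a}
      ≤ Nat.card (CommGroup.primaryComponent
          (Multiplicative (AddCommGroup.torsion V.toAffine.Point)) p) :=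
        Nat.card_le_card_of_injective F hF
    _ = p ^ (Nat.card (Multiplicative (AddCommGroup.torsion V.toAffine.Point))).factorization p :=
        card_primaryComponent_eq_pow p
    _ = p ^ (V.torsionOrder).factorization p := by
        rw [Nat.card_congr Multiplicative.toAdd]; rfl

omit [W.IsElliptic] [W.IsGloballyMinimal] hp in
/-- **A rational point of order `p` is a `ℚ_v`-point of order `p`** (the datum `hPt` of the
`#S + 2` counts, free at a member with rational `p`-torsion): `E(ℚ) ↪ E(ℚ_v)`. [folklore] -/
theorem exists_point_baseChange_of_rationalPoint (v : HeightOneSpectrum (𝓞 ℚ))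
    (hPt : ∃ P : W.toAffine.Point, P ≠ 0 ∧ p • P = 0) :
    ∃ Q : (W.baseChange (v.adicCompletion ℚ)).toAffine.Point, Q ≠ 0 ∧ p • Q = 0 := by
  obtain ⟨P, hP0, hPp⟩ := hPt
  have e0 : W.baseChange ℚ = W := by
    rw [WeierstrassCurve.baseChange, Algebra.algebraMap_self, WeierstrassCurve.map_id]
  let ι := Affine.Point.map (W' := W) (Algebra.ofId ℚ (v.adicCompletion ℚ))
  have hι : Function.Injective ι := Affine.Point.map_injective (W' := W) _
  refine ⟨ι (Affine.Point.congrEquiv e0.symm P), fun h ↦ hP0 ?_, ?_⟩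
  · have h1 : Affine.Point.congrEquiv e0.symm P = 0 := hι (by rw [h, map_zero])
    exact (Affine.Point.congrEquiv e0.symm).injective (by rw [h1, map_zero])
  · rw [← map_nsmul, ← map_nsmul, hPp, map_zero, map_zero]

end Dictionary

/-! ## §8. The leaf ends from the RATIONAL data: a point of order `p` in `E(ℚ)` and `v_p(#E(ℚ)_tors) ≤ k` -/

section LeafRat

open Literature.NumberTheory.EllipticCurves.Rank1Residual
  Literature.NumberTheory.EllipticCurves.ModularForms
  Literature.NumberTheory.EllipticCurves.Greenberg1999
  Summit.BirchSwinnertonDyer.BirchSwinnertonDyer.Theorems.Rank1ResidualX1Defs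
  Summit.BirchSwinnertonDyer.Rank1Residual.X1.MuLambda
  Summit.BirchSwinnertonDyer.Rank1Residual.X1.MuPart
  Summit.BirchSwinnertonDyer.Rank1Residual.X1.ParitySqueeze
  Summit.BirchSwinnertonDyer.Rank1Residual.X1.TamagawaSqueeze
  Summit.BirchSwinnertonDyer.Rank1Residual.X1.FactorSqueeze
  Summit.BirchSwinnertonDyer.Rank1Residual.X1.GeneratorSqueeze
  Summit.BirchSwinnertonDyer.Rank1Residual.X1.GeneratorCountSqueeze
  Summit.BirchSwinnertonDyer.Rank1Residual.X1.GeneratorCountSqueezeFacts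
  Summit.BirchSwinnertonDyer.Rank1Residual.X1.GeneratorCountAnomalousLeaf

/-- **The count on the leaf from RATIONAL data**: a leaf pair `(E, p)`, places `S ∌ p` with
`p ∣ c_v(E)`, a rational point of order `p`, and `v_p(#E(ℚ)_tors) ≤ k` ⇒ `GeneratorCountGE W p b`
for every `b + 2k ≤ #S + 2` (with `k = 1`: `b = #S = t₀`, X1R0-GAPMAP §14.1 at `δ = 1`).
Named facts `hPT`, `hGrK`. [cite: GreenbergLNM1716, §2 Prop. 2.4, §3 Lemma 3.1/3.4, §5, p. 137] -/
theorem Leaf.generatorCountGE_of_rationalTorsion (hPT : poitouTate_selmerStructure_duality ℚ)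
    (hGrK : imKummer_ge_strictCondition_goodOrdinary) (hL : RankZero.Leaf W p) {k : ℕ}
    (hk : (W.torsionOrder).factorization p ≤ k)
    (hPt : ∃ P : W.toAffine.Point, P ≠ 0 ∧ p • P = 0)
    (S : Finset (HeightOneSpectrum (𝓞 ℚ))) (hSp : ∀ v ∈ S, ((p : ℕ) : 𝓞 ℚ) ∉ v.asIdeal)
    (hcv : ∀ v ∈ S,
      p ∣ (W.baseChange (v.adicCompletion ℚ)).localTamagawaNumber (v.adicCompletionIntegers ℚ))
    (vp : HeightOneSpectrum (𝓞 ℚ)) (hvp : ((p : ℕ) : 𝓞 ℚ) ∈ vp.asIdeal)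
    {b : ℕ} (hb : b + 2 * k ≤ S.card + 2) : GeneratorCountGE W p b :=
  Leaf.generatorCountGE_torsion hPT hGrK hL
    ((natCard_fixedPoints_le_pow_factorization_torsionOrder W p).trans
      (Nat.pow_le_pow_right hp.out.pos hk))
    S hSp hcv vp hvp (exists_point_baseChange_of_rationalPoint vp hPt) hb

/-- **ROUTE M at the `μ = 0` member from RATIONAL torsion data** (`δ = 1`; count `b`,
`b + 2k ≤ #S + 2`, `v_p(#E(ℚ)_tors) ≤ k`, a rational point of order `p`).
[cite: GreenbergLNM1716, §2 Prop. 2.4, §3 Lemma 3.1/3.4, Prop. 3.10, Thm. 4.1, §5 pp. 114–118, p. 137]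
[cite: Wuthrich2014, Thm. 16 (p. 397)] -/
theorem Leaf.bsdp_of_muZero_of_tamagawaCount_rationalTorsion
    (hW16 : Wuthrich2014.charIdeal_dvd_padicLFunction) (hGr : greenberg_charValue_rankZero)
    (h310 : prop310_selmerCorank_mod_two_eq_lambdaInvariant)
    (h415 : prop415ii_noFiniteSubmodule_of_ordinary_or_multiplicative)
    (hmod : nonempty_modularParametrizationData)
    (hGZK : rank_eq_analyticRank_of_analyticRank_le_one)
    (hPT : poitouTate_selmerStructure_duality ℚ) (hGrK : imKummer_ge_strictCondition_goodOrdinary)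
    (hL : RankZero.Leaf W p) {k : ℕ} (hk : (W.torsionOrder).factorization p ≤ k)
    (hPt : ∃ P : W.toAffine.Point, P ≠ 0 ∧ p • P = 0)
    (hμ0 : AnalyticMuLE W p 0) {n b : ℕ} {S' : Set (ℕ × ℕ)} (hlam : AnalyticLambdaEq W p n)
    (S : Finset (HeightOneSpectrum (𝓞 ℚ))) (hSp : ∀ v ∈ S, ((p : ℕ) : 𝓞 ℚ) ∉ v.asIdeal)
    (hcv : ∀ v ∈ S,
      p ∣ (W.baseChange (v.adicCompletion ℚ)).localTamagawaNumber (v.adicCompletionIntegers ℚ))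
    (vp : HeightOneSpectrum (𝓞 ℚ)) (hvp : ((p : ℕ) : 𝓞 ℚ) ∈ vp.asIdeal)
    (hb : b + 2 * k ≤ S.card + 2) (hS : AnalyticLamConstValDivisorSet W p S')
    (hgap : ∀ d v, (d, v) ∈ S' → b ≤ v → Even d → d ≤ n → n ≤ d + 1) : BSDp W p :=
  Leaf.bsdp_of_muZero_of_generatorCount_of_prop415 hW16 hGr h310 h415 hmod hGZK hL hμ0 hlam
    (Leaf.generatorCountGE_of_rationalTorsion hPT hGrK hL hk hPt S hSp hcv vp hvp hb) hS hgap

/-- **The same intersected with a second membership certificate** (M₀ ∘ C shape).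
[cite: GreenbergLNM1716, §2 Prop. 2.4, Prop. 3.10, Thm. 4.1, §5 pp. 114–118, pp. 132, 137] [cite: Wuthrich2014, Thm. 16 (p. 397)] -/
theorem Leaf.bsdp_of_muZero_of_tamagawaCount_rationalTorsion_inter
    (hW16 : Wuthrich2014.charIdeal_dvd_padicLFunction) (hGr : greenberg_charValue_rankZero)
    (h310 : prop310_selmerCorank_mod_two_eq_lambdaInvariant)
    (h415 : prop415ii_noFiniteSubmodule_of_ordinary_or_multiplicative)
    (hmod : nonempty_modularParametrizationData)
    (hGZK : rank_eq_analyticRank_of_analyticRank_le_one)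
    (hPT : poitouTate_selmerStructure_duality ℚ) (hGrK : imKummer_ge_strictCondition_goodOrdinary)
    (hL : RankZero.Leaf W p) {k : ℕ} (hk : (W.torsionOrder).factorization p ≤ k)
    (hPt : ∃ P : W.toAffine.Point, P ≠ 0 ∧ p • P = 0)
    (hμ0 : AnalyticMuLE W p 0) {n b : ℕ} {S' : Set (ℕ × ℕ)} {A' : Set ℕ}
    (hlam : AnalyticLambdaEq W p n) (S : Finset (HeightOneSpectrum (𝓞 ℚ)))
    (hSp : ∀ v ∈ S, ((p : ℕ) : 𝓞 ℚ) ∉ v.asIdeal)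
    (hcv : ∀ v ∈ S,
      p ∣ (W.baseChange (v.adicCompletion ℚ)).localTamagawaNumber (v.adicCompletionIntegers ℚ))
    (vp : HeightOneSpectrum (𝓞 ℚ)) (hvp : ((p : ℕ) : 𝓞 ℚ) ∈ vp.asIdeal)
    (hb : b + 2 * k ≤ S.card + 2) (hS : AnalyticLamConstValDivisorSet W p S')
    (hA' : AlgebraicLambdaMem W p A')
    (hgap : ∀ d v, (d, v) ∈ S' → b ≤ v → d ∈ A' → Even d → d ≤ n → n ≤ d + 1) : BSDp W p :=
  Leaf.bsdp_of_muZero_of_generatorCount_inter_of_prop415 hW16 hGr h310 h415 hmod hGZK hL hμ0 hlam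
    (Leaf.generatorCountGE_of_rationalTorsion hPT hGrK hL hk hPt S hSp hcv vp hvp hb) hS hA' hgap

/-- **ROUTE M at a `μ ≥ 1` member from RATIONAL torsion data** (μ-part `MuPartAt W p`).
[cite: GreenbergLNM1716, §2 Prop. 2.4, §3 Lemma 3.1/3.4, Prop. 3.10, Thm. 4.1, §5 pp. 114–118, p. 137]
[cite: Wuthrich2014, Thm. 16 (p. 397)] -/
theorem Leaf.bsdp_of_muPartAt_of_tamagawaCount_rationalTorsion
    (hW16 : Wuthrich2014.charIdeal_dvd_padicLFunction) (hGr : greenberg_charValue_rankZero)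
    (h310 : prop310_selmerCorank_mod_two_eq_lambdaInvariant)
    (h415 : prop415ii_noFiniteSubmodule_of_ordinary_or_multiplicative)
    (hmod : nonempty_modularParametrizationData)
    (hGZK : rank_eq_analyticRank_of_analyticRank_le_one)
    (hPT : poitouTate_selmerStructure_duality ℚ) (hGrK : imKummer_ge_strictCondition_goodOrdinary)
    (hL : RankZero.Leaf W p) {k : ℕ} (hk : (W.torsionOrder).factorization p ≤ k)
    (hPt : ∃ P : W.toAffine.Point, P ≠ 0 ∧ p • P = 0)
    (hμ : MuPartAt W p) {n b : ℕ} {S' : Set (ℕ × ℕ)} (hlam : AnalyticLambdaEq W p n)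
    (S : Finset (HeightOneSpectrum (𝓞 ℚ))) (hSp : ∀ v ∈ S, ((p : ℕ) : 𝓞 ℚ) ∉ v.asIdeal)
    (hcv : ∀ v ∈ S,
      p ∣ (W.baseChange (v.adicCompletion ℚ)).localTamagawaNumber (v.adicCompletionIntegers ℚ))
    (vp : HeightOneSpectrum (𝓞 ℚ)) (hvp : ((p : ℕ) : 𝓞 ℚ) ∈ vp.asIdeal)
    (hb : b + 2 * k ≤ S.card + 2) (hS : AnalyticLamConstValDivisorSet W p S')
    (hgap : ∀ d v, (d, v) ∈ S' → b ≤ v → Even d → d ≤ n → n ≤ d + 1) : BSDp W p :=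
  Leaf.bsdp_of_muPartAt_of_generatorCount_of_prop415 hW16 hGr h310 h415 hmod hGZK hL hμ hlam
    (Leaf.generatorCountGE_of_rationalTorsion hPT hGrK hL hk hPt S hSp hcv vp hvp hb) hS hgap

end LeafRat

end Summit.BirchSwinnertonDyer.Rank1Residual.X1.GeneratorCountTorsion

end
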